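import Summits.AnomalousDissipation.AnomalousDissipation.Theorems.MarginalStabilityChainStrainedLayerLawSumRuleLine

/-!
# Crux `MarginalStabilityChain.StrainedLayerLaw` (stmt-AnomalousDissipation-3007), line `strain-work-sum-rule`:
# reshape 2 — the sublinear-energy stub split into slice kinematics + uniform vorticity bounds

Support file (`--supports stmt-AnomalousDissipation-3007`; registered sub-goal
`excessEnergySublinear_of_vorticityBounds`). Lead reshape 2 (continuation lead c1, 2026-08-16, after worker W4's
audit of `stub_excessEnergySublinear`): the fixed-`ν` statement "`E(T) ≤ εT` eventually" (hypothesis `h4` of the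
landed composition `StrainedLayerLaw_of_sumRuleStubs`) is the 8-line consequence of two registered stubs,

* `stub_excessEnergyKinematic` (slice level, TRUE, size M–L): for a `C²` divergence-free `L`-periodic slice with
  the shear far field and shear tails, `E ≤ ½[(L/2π)²Ω + A·M₁/L] + ½M₁` in terms of the cell's vorticity norms
  `A = ∫∫|ω|`, `Ω = ∫∫ω²`, `M₁ = ∫∫|y||ω|` (decomposition `E = ½‖w − (sgn y/2, 0)‖² + ½∫∫|y|ω`, `ū′ = −ω̄`,
  Wirtinger in `x` for the fluctuation and for `v`, `‖∇w‖₂² = ‖ω‖₂²` under the tails — no Biot–Savart);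
* `stub_vorticityUniformBounds` (dynamics at FIXED `ν`, TRUE, size XL): for a classical solution on `(0,∞)` with
  shear tails on every compact time interval, `∫∫|ω|`, `∫∫ω²`, `∫∫|y||ω|` are bounded uniformly for `t ≥ 1`
  (Kato `L¹`-antitonicity of the conservation form `∂ₜω + div(ω(u, v − y)) = νΔω`, the enstrophy law with a Nash
  inequality on the cylinder, and first-moment confinement by the compression);

proved here as `excessEnergySublinear_of_vorticityBounds` (pure bookkeeping: at a late time `T` take the tails
constants on `[T, T+1]`, apply the kinematic bound with the uniform vorticity bounds, and choose
`T ≥ max 1 (K/ε)`). No facts are asserted. References: worker memo `work/stubs/stub_excessEnergySublinear.md`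
(lead's folder); Majda–Bertozzi 2002 §3.1 (energy method vocabulary).
-/

-- `Summit.<Summit>.<Problem>` is the tree's mandated summit-side namespace (CONVENTIONS §2); for this
-- single-conjunct summit the two coincide, so the duplicate is deliberate.
set_option linter.dupNamespace false

noncomputable section

open scoped Topology ENNReal
open Filter Set Function MeasureTheory

namespace Summit.AnomalousDissipation.AnomalousDissipation.Theorems.StrainedLayerLaw.StrainWorkSumRule

open Literature.Analysis.FluidPDE Literature.Analysis.FluidPDE.StretchedLayer

/-- **Reshape 2 of the line (registered sub-goal): slice kinematics + uniform vorticity bounds ⇒ sublinear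
excess energy.** If (h4a) every `C²` divergence-free `L`-periodic slice with the shear far field and shear tails
satisfies `excessEnergy L u v ≤ ((L/2π)²Ω + A·M₁/L)/2 + M₁/2` whenever `∫∫|ω| ≤ A`, `∫∫ω² ≤ Ω`,
`∫∫|y||ω| ≤ M₁`, and (h4b) every classical solution on `(0,∞)` with shear tails on every `[a,b] ⊂ (0,∞)` has
these three vorticity norms bounded uniformly for `t ≥ 1`, then every member of the crux's class with locally
finite dissipation and such tails has `E(T) ≤ εT` eventually, for every `ε > 0` — verbatim hypothesis `h4` of
`StrainedLayerLaw_of_sumRuleStubs`. [folklore] -/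
theorem excessEnergySublinear_of_vorticityBounds
    (h4a : ∀ (L C k : ℝ), 0 < L → 0 < k → ∀ (u v : ℝ → ℝ → ℝ),
        ContDiff ℝ 2 (fun q : ℝ × ℝ => u q.1 q.2) → ContDiff ℝ 2 (fun q : ℝ × ℝ => v q.1 q.2) →
        (∀ x y, dX u x y + dY v x y = 0) →
        (∀ x y, u (x + L) y = u x y) → (∀ x y, v (x + L) y = v x y) →
        (∀ x, Tendsto (fun y => u x y) atTop (𝓝 (1 / 2))) →
        (∀ x, Tendsto (fun y => u x y) atBot (𝓝 (-(1 / 2)))) →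
        (∀ x, Tendsto (fun y => v x y) atTop (𝓝 0)) →
        (∀ x, Tendsto (fun y => v x y) atBot (𝓝 0)) →
        SliceTails C k u v →
        ∀ (A Ω M₁ : ℝ),
          (∫ x in Ioc 0 L, ∫ y, |vorticity u v x y|) ≤ A →
          (∫ x in Ioc 0 L, ∫ y, vorticity u v x y ^ 2) ≤ Ω →
          (∫ x in Ioc 0 L, ∫ y, |y| * |vorticity u v x y|) ≤ M₁ →
            excessEnergy L u v ≤ ((L / (2 * Real.pi)) ^ 2 * Ω + A * M₁ / L) / 2 + M₁ / 2)
    (h4b : ∀ (ν L : ℝ), 0 < ν → 0 < L → ∀ (u v p : ℝ → ℝ → ℝ → ℝ),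
        IsStretchedLayerNSSolutionOn (Ioi 0) ν 1 1 L u v p →
        (∀ a b : ℝ, 0 < a → a < b → ExpTails (Icc a b) u v) →
          ∃ A B M : ℝ, ∀ t : ℝ, 1 ≤ t →
            (∫ x in Ioc 0 L, ∫ y, |vorticity (u t) (v t) x y|) ≤ A ∧
            (∫ x in Ioc 0 L, ∫ y, vorticity (u t) (v t) x y ^ 2) ≤ B ∧
            (∫ x in Ioc 0 L, ∫ y, |y| * |vorticity (u t) (v t) x y|) ≤ M) :
    ∀ (ν L : ℝ), 0 < ν → 0 < L → ∀ (θ₁ θ₂ : ℝ → ℝ → ℝ), IsAdmissible L θ₁ θ₂ →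
      ∀ (u v p : ℝ → ℝ → ℝ → ℝ), InCruxClass ν L θ₁ θ₂ u v p →
        (∀ T : ℝ, 0 < T → ∫⁻ t in Ioc 0 T, layerDissipation ν L (u t) (v t) ≠ ∞) →
        (∀ a b : ℝ, 0 < a → a < b → ExpTails (Icc a b) u v) →
          ∀ ε : ℝ, 0 < ε → ∀ᶠ T in atTop, excessEnergy L (u T) (v T) ≤ ε * T := by
  intro ν L hν hL θ₁ θ₂ _hθ u v p hcl _hfin htails ε hε
  have hsol : IsStretchedLayerNSSolutionOn (Ioi 0) ν 1 1 L u v p := hcl.isSolution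
  obtain ⟨A, B, M, hbd⟩ := h4b ν L hν hL u v p hsol htails
  set K : ℝ := ((L / (2 * Real.pi)) ^ 2 * B + A * M / L) / 2 + M / 2 with hK
  filter_upwards [eventually_ge_atTop (1 : ℝ), eventually_ge_atTop (K / ε)] with T hT1 hTK
  -- tails constants on `[T, T + 1]` give `SliceTails C k (u T) (v T)`
  obtain ⟨C, k, hk, hCk⟩ := htails T (T + 1) (one_pos.trans_le hT1) (lt_add_one T)
  have hST : SliceTails C k (u T) (v T) := (hCk T ⟨le_rfl, (lt_add_one T).le⟩).1
  have hT0 : T ∈ Ioi (0 : ℝ) := one_pos.trans_le hT1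
  obtain ⟨hA, hB, hM⟩ := hbd T hT1
  have hE : excessEnergy L (u T) (v T) ≤ K :=
    h4a L C k hL hk (u T) (v T) (hsol.contDiff_u hT0) (hsol.contDiff_v hT0) (hsol.divFree T hT0)
      (hsol.periodic_u T hT0) (hsol.periodic_v T hT0) (hsol.tendsto_u_atTop T hT0)
      (hsol.tendsto_u_atBot T hT0) (hsol.tendsto_v_atTop T hT0) (hsol.tendsto_v_atBot T hT0) hST
      A B M hA hB hM
  have hKT : K ≤ ε * T := by
    have h := (div_le_iff₀ hε).1 hTK
    linarith [mul_comm T ε]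
  exact hE.trans hKT

end Summit.AnomalousDissipation.AnomalousDissipation.Theorems.StrainedLayerLaw.StrainWorkSumRule

end
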